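import Literature.Geometry.ComplexAnalytic.RelativeExponentialChartComparison   -- ★ `IsRelExpChartOn`, `continuousOn_period_symm_clm`
import Mathlib.Topology.Connected.TotallyDisconnected
import HarnessLib

/-!
# The chart coordinate of a continuous TORSION section is constant along a relative exponential chart
# ([BirkenhakeLange2004] §8.7 Lemma 8.7.1; [DeligneHodgeII1971] §4.4 (4.4.2): `R₁f_*ℤ` is a local system; [Shimura1963AnalyticFamilies] §2)

Layer `Literature/Geometry/ComplexAnalytic`, namespace `Literature.Geometry.ComplexAnalytic.IsRelExpChartOn`.  THEOREMS ONLY (no definition,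
no named fact, no instance, no notation, no `sorry`).  Cell `hodgecm-mathlib` (D-0151), FLOOR 0, P6 «MOD» (crux hLiu418 =
stmt-HodgeConjecture-24832, `--supports`), half A line L7, socket `stub_UNIVFAM` (★ P-3 `siegelUniversalFamilyUniformisation`), organ O3 `stub_FLAT`,
sub-organ **FLAT-b(i) «LEVEL READINGS ARE CONSTANT ALONG A CHART»**, GENERIC CORE (LA7-plan RULING 2026-09-02T02:22Z (4); interface
LA7-p01 (g0) v1 (L=)).  HC_CM is proved only modulo the printed citations until rung 0 closes; this file is generic and changes no count.

THE MATHEMATICS.  Let `ex : B × E → M` be a relative exponential chart of `p : M → B` over `U` with period family `Φ` (★ `IsRelExpChartOn`),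
and let `σ` be a CONTINUOUS SECTION of `p` over a preconnected `V ⊆ U` whose chart coordinate at every point is an `m`-DIVISION VALUE of the
lattice: `σ b = ex (b, Φ b x_b)` with `m · x_b ∈ ℤ^ι` (e.g. an `m`-torsion section of an analytic family of complex tori).  Then the chart
coordinate is CONSTANT: if `σ b₀ = ex (b₀, Φ b₀ x₀)` at one `b₀ ∈ V`, then `σ b = ex (b, Φ b x₀)` at every `b ∈ V` (`sectionReading_const`).
Indeed near any `b₁` the étale clause of the chart writes `σ b = ex (b, z b)` with `z` continuous, the kernel clause puts
`(Φ b)⁻¹ (z b)` in the discrete set `m⁻¹ℤ^ι`, and `b ↦ (Φ b)⁻¹` is continuous (★ `continuousOn_period_symm_clm`), so the reading is locally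
constant (`eventually_sectionReading_of_reading`); a locally constant reading on a preconnected `V` is constant (Mathlib `IsPreconnected.constant`).
In print this is the statement that torsion sections of `A^an → S^an` are sections of the LOCAL SYSTEM `R₁f_*ℤ ⊗ ℚ∕ℤ` ([DeligneHodgeII1971] (4.4.2):
`0 → R₁f_*ℤ → Lie → A^an → 0`), i.e. have locally constant coordinates in any local frame of `R₁f_*ℤ` ([BirkenhakeLange2004] §8.7 Lemma 8.7.1 for
the universal family over `𝔥_g`).  Consumed by the L7 head «the level sections of `P_T` read the SAME rational vector through the chart frame
at every `t` of a connected chart domain» (interface (L=) of FLAT-c).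

* `reading_unique_mod` — two readings of one point differ by a lattice vector; `reading_of_add_int` — readings are lattice-periodic;
* `eventually_sectionReading_of_reading` — LOCAL CONSTANCY of the reading of a continuous `m`-division section;
* `sectionReading_const` — THE HEAD: constancy on a preconnected `V`.

## References
* [BirkenhakeLange2004] C. Birkenhake, H. Lange, *Complex Abelian Varieties*, 2nd ed. (2004), Ch. 8 §8.7 Lemma 8.7.1 pp. 229–231.
* [DeligneHodgeII1971] P. Deligne, *Théorie de Hodge II*, Publ. Math. IHÉS 40 (1971), §4.4 (4.4.2)–(4.4.3) pp. 50–51.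
* [Shimura1963AnalyticFamilies] G. Shimura, *On analytic families of polarized abelian varieties and automorphic functions*, Ann. Math. 78 (1963), §2.
-/

set_option autoImplicit false

noncomputable section

open scoped Manifold Topology
open Set Filter Function

namespace Literature.Geometry.ComplexAnalytic.IsRelExpChartOn

variable {EB : Type*} [NormedAddCommGroup EB] [NormedSpace ℂ EB] {B : Type*} [TopologicalSpace B] [ChartedSpace EB B]
  {E : Type*} [NormedAddCommGroup E] [NormedSpace ℂ E] {ι : Type*} [Fintype ι] [DecidableEq ι]
  {EM : Type*} [NormedAddCommGroup EM] [NormedSpace ℂ EM] {M : Type*} [TopologicalSpace M] [ChartedSpace EM M]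
  {p : M → B} {U : Set B} {Φ : B → ((ι → ℝ) ≃L[ℝ] E)} {ex : B × E → M}

omit [Fintype ι] [DecidableEq ι] in
/-- Two chart readings of one point of the fibre over `b ∈ U` differ by an INTEGER vector. [cite: BirkenhakeLange2004, §1.1] -/
theorem reading_unique_mod (h : IsRelExpChartOn EB EM p U Φ ex) {b : B} (hb : b ∈ U) {x x' : ι → ℝ}
    (hxx' : ex (b, Φ b x) = ex (b, Φ b x')) : ∃ n : ι → ℤ, x' = x + fun i => (n i : ℝ) := by
  obtain ⟨n, hn⟩ := h.exists_int_of_ex_eq hb hxx'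
  refine ⟨n, (Φ b).injective ?_⟩
  rw [hn, map_add]

omit [Fintype ι] [DecidableEq ι] in
/-- Chart readings are lattice-periodic: `ex (b, Φ b (x + n)) = ex (b, Φ b x)` for an integer vector `n`. [cite: BirkenhakeLange2004, §1.1] -/
theorem reading_of_add_int (h : IsRelExpChartOn EB EM p U Φ ex) {b : B} (hb : b ∈ U) (x : ι → ℝ) (n : ι → ℤ) :
    ex (b, Φ b (x + fun i => (n i : ℝ))) = ex (b, Φ b x) := by
  rw [map_add]
  exact h.ex_add_period hb (Φ b x) n

omit [Fintype ι] [DecidableEq ι] in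
/-- An `m`-division vector shifted by an integer vector is an `m`-division vector (plumbing). [folklore] -/
private theorem isDiv_add_int {m : ℕ} {x : ι → ℝ} (hx : ∀ i, ∃ k : ℤ, (m : ℝ) * x i = k) (n : ι → ℤ) :
    ∀ i, ∃ k : ℤ, (m : ℝ) * (x + fun i => (n i : ℝ)) i = k := by
  intro i
  obtain ⟨k, hk⟩ := hx i
  exact ⟨k + m * n i, by simp only [Pi.add_apply, mul_add, hk]; push_cast; ring⟩

omit [Fintype ι] [DecidableEq ι] in
/-- Two `m`-division vectors (`m ≠ 0`) at sup-distance `< 1/m` in one coordinate agree in that coordinate (plumbing). [folklore] -/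
private theorem eq_of_isDiv_of_abs_sub_lt {m : ℕ} (hm : m ≠ 0) {a c : ℝ} (ha : ∃ k : ℤ, (m : ℝ) * a = k) (hc : ∃ k : ℤ, (m : ℝ) * c = k)
    (hac : |a - c| < 1 / m) : a = c := by
  obtain ⟨k, hk⟩ := ha
  obtain ⟨l, hl⟩ := hc
  have hm0 : (0 : ℝ) < m := by exact_mod_cast Nat.pos_of_ne_zero hm
  have h1 : |(k : ℝ) - l| < 1 := by
    rw [← hk, ← hl, ← mul_sub, abs_mul, abs_of_pos hm0]
    calc (m : ℝ) * |a - c| < m * (1 / m) := mul_lt_mul_of_pos_left hac hm0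
      _ = 1 := by field_simp
  have h2 : k = l := by
    have : |((k - l : ℤ) : ℝ)| < 1 := by push_cast; exact h1
    rw [← Int.cast_abs] at this
    have h3 : |k - l| < 1 := by exact_mod_cast this
    have h4 := abs_lt.1 h3
    omega
  have h4 : (m : ℝ) * a = (m : ℝ) * c := by rw [hk, hl, h2]
  exact mul_left_cancel₀ hm0.ne' h4

/-- **LOCAL CONSTANCY OF THE READING OF A CONTINUOUS `m`-DIVISION SECTION**: if `σ` is continuous within `V ⊆ U` at `b₁ ∈ V`, lies over `p`
on `V`, reads `m`-division vectors everywhere on `V` (`σ b = ex (b, Φ b x_b)`, `m · x_b ∈ ℤ^ι`, `m ≠ 0`), and reads `x₁` at `b₁`, then it reads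
`x₁` at all points of `V` near `b₁` (étale clause + kernel clause of the chart + continuity of `b ↦ (Φ b)⁻¹`).
[cite: BirkenhakeLange2004, §8.7 Lemma 8.7.1] [cite: DeligneHodgeII1971, §4.4 (4.4.2) p. 50] -/
theorem eventually_sectionReading_of_reading (h : IsRelExpChartOn EB EM p U Φ ex) {V : Set B} (hVU : V ⊆ U)
    {σ : B → M} (hpσ : ∀ b ∈ V, p (σ b) = b) {m : ℕ} (hm : m ≠ 0)
    (hdiv : ∀ b ∈ V, ∃ x : ι → ℝ, (∀ i, ∃ k : ℤ, (m : ℝ) * x i = k) ∧ σ b = ex (b, Φ b x))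
    {b₁ : B} (hb₁ : b₁ ∈ V) (hσ : ContinuousWithinAt σ V b₁) {x₁ : ι → ℝ} (hx₁ : σ b₁ = ex (b₁, Φ b₁ x₁)) :
    ∀ᶠ b in 𝓝[V] b₁, σ b = ex (b, Φ b x₁) := by
  -- `x₁` itself is an `m`-division vector
  have hx₁div : ∀ i, ∃ k : ℤ, (m : ℝ) * x₁ i = k := by
    obtain ⟨x, hxdiv, hx⟩ := hdiv b₁ hb₁
    obtain ⟨n, rfl⟩ := h.reading_unique_mod (hVU hb₁) (hx.symm.trans hx₁)
    exact isDiv_add_int hxdiv n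
  -- the étale local inverse at `(b₁, Φ b₁ x₁)`
  obtain ⟨e, hsrc, hsub, heq, -⟩ := h.exists_localInverse (b₁, Φ b₁ x₁) ⟨hVU hb₁, mem_univ _⟩
  have htgt : σ b₁ ∈ e.target := by
    rw [hx₁, ← heq _ hsrc]
    exact e.map_source hsrc
  -- `z b :=` the `E`-coordinate of `e⁻¹ (σ b)`, continuous within `V` at `b₁`, with `z b₁ = Φ b₁ x₁`
  have hzc : ContinuousWithinAt (fun b => (e.symm (σ b)).2) V b₁ :=
    ((e.continuousOn_symm.continuousAt (e.open_target.mem_nhds htgt)).comp_continuousWithinAt hσ).snd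
  have hz₁ : (e.symm (σ b₁)).2 = Φ b₁ x₁ := by
    rw [hx₁, ← heq _ hsrc, e.left_inv hsrc]
  -- `y b := (Φ b)⁻¹ (z b)`, continuous within `V` at `b₁`, with `y b₁ = x₁`
  set y : B → (ι → ℝ) := fun b => (Φ b).symm (e.symm (σ b)).2 with hydef
  have hyc : ContinuousWithinAt y V b₁ := by
    have hΦc : ContinuousWithinAt (fun b => ((Φ b).symm : E →L[ℝ] (ι → ℝ))) V b₁ :=
      ((h.continuousOn_period_symm_clm) b₁ (hVU hb₁)).mono hVU
    exact ((isBoundedBilinearMap_apply (𝕜 := ℝ) (E := E) (F := ι → ℝ)).continuous.continuousAt).comp_continuousWithinAt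
      (hΦc.prodMk hzc)
  have hy₁ : y b₁ = x₁ := by
    simp only [hydef]
    rw [hz₁, ContinuousLinearEquiv.symm_apply_apply]
  -- eventually: `σ b ∈ e.target`, so `σ b = ex (b, z b)` and `y b ∈ m⁻¹ℤ^ι`; and `‖y b - x₁‖ < 1/m`
  have hev₁ : ∀ᶠ b in 𝓝[V] b₁, σ b ∈ e.target := hσ (e.open_target.mem_nhds htgt)
  have hm' : (0 : ℝ) < 1 / m := by positivity
  have hev₂ : ∀ᶠ b in 𝓝[V] b₁, dist (y b) x₁ < 1 / m := by
    have htend : Tendsto y (𝓝[V] b₁) (𝓝 x₁) := by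
      have := hyc.tendsto
      rwa [hy₁] at this
    exact htend (Metric.ball_mem_nhds x₁ hm')
  filter_upwards [hev₁, hev₂, self_mem_nhdsWithin] with b hbt hbd hbV
  -- `σ b = ex (b, z b)` with `z b` in the fibre coordinate over `b`
  have hq : e.symm (σ b) ∈ e.source := e.map_target hbt
  have hexq : ex (e.symm (σ b)) = σ b := by rw [← heq _ hq, e.right_inv hbt]
  have hq1 : (e.symm (σ b)).1 = b := by
    have := h.p_ex (e.symm (σ b)).1 (hsub hq).1 (e.symm (σ b)).2
    rw [Prod.mk.eta, hexq, hpσ b hbV] at this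
    exact this.symm
  have hσz : σ b = ex (b, (e.symm (σ b)).2) := by
    calc σ b = ex (e.symm (σ b)) := hexq.symm
      _ = ex (b, (e.symm (σ b)).2) := by
          congr 1
          exact Prod.ext hq1 rfl
  -- the reading `x_b` and the coordinate `y b` differ by an integer vector, so `y b ∈ m⁻¹ℤ^ι`
  obtain ⟨x, hxdiv, hx⟩ := hdiv b hbV
  have hydiv : ∀ i, ∃ k : ℤ, (m : ℝ) * y b i = k := by
    have hrd : ex (b, Φ b x) = ex (b, Φ b (y b)) := by
      rw [hydef, ContinuousLinearEquiv.apply_symm_apply, ← hσz, ← hx]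
    obtain ⟨n, hn⟩ := h.reading_unique_mod (hVU hbV) hrd
    rw [hn]
    exact isDiv_add_int hxdiv n
  -- discreteness: `y b = x₁`
  have hyx : y b = x₁ := by
    funext i
    refine eq_of_isDiv_of_abs_sub_lt hm (hydiv i) (hx₁div i) (lt_of_le_of_lt ?_ hbd)
    rw [dist_eq_norm]
    exact norm_le_pi_norm (y b - x₁) i
  have hz : (e.symm (σ b)).2 = Φ b x₁ := by
    rw [← hyx, hydef, ContinuousLinearEquiv.apply_symm_apply]
  rw [hσz, hz]

/-- **THE READING OF A CONTINUOUS `m`-DIVISION SECTION IS CONSTANT ON A PRECONNECTED SET** (FLAT-b(i) core; [BirkenhakeLange2004] §8.7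
Lemma 8.7.1; [DeligneHodgeII1971] (4.4.2): torsion sections are sections of the local system `R₁f_*ℤ ⊗ ℚ∕ℤ`): let `σ` be continuous on a
preconnected `V ⊆ U`, lying over `p`, reading `m`-division vectors at every point of `V` (`m ≠ 0`).  If `σ b₀ = ex (b₀, Φ b₀ x₀)` at some
`b₀ ∈ V`, then `σ b = ex (b, Φ b x₀)` at EVERY `b ∈ V`.
[cite: BirkenhakeLange2004, §8.7 Lemma 8.7.1] [cite: DeligneHodgeII1971, §4.4 (4.4.2) p. 50] [cite: Shimura1963AnalyticFamilies, §2] -/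
theorem sectionReading_const (h : IsRelExpChartOn EB EM p U Φ ex) {V : Set B} (hVU : V ⊆ U) (hV : IsPreconnected V)
    {σ : B → M} (hσ : ContinuousOn σ V) (hpσ : ∀ b ∈ V, p (σ b) = b) {m : ℕ} (hm : m ≠ 0)
    (hdiv : ∀ b ∈ V, ∃ x : ι → ℝ, (∀ i, ∃ k : ℤ, (m : ℝ) * x i = k) ∧ σ b = ex (b, Φ b x))
    {b₀ : B} (hb₀ : b₀ ∈ V) {x₀ : ι → ℝ} (hx₀ : σ b₀ = ex (b₀, Φ b₀ x₀)) :
    ∀ b ∈ V, σ b = ex (b, Φ b x₀) := by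
  classical
  -- the indicator of «`σ` reads `x₀`» is continuous on `V` into the discrete space `Bool`
  let f : B → Bool := fun b => decide (σ b = ex (b, Φ b x₀))
  have hf : ContinuousOn f V := by
    intro b₁ hb₁
    by_cases hb : σ b₁ = ex (b₁, Φ b₁ x₀)
    · -- reads `x₀` at `b₁`, hence nearby
      have hev := h.eventually_sectionReading_of_reading hVU hpσ hm hdiv hb₁ (hσ b₁ hb₁) hb
      refine (continuousWithinAt_const (b := true)).congr_of_eventuallyEq ?_ (by simp [f, hb])
      filter_upwards [hev] with b hb'
      simp [f, hb']
    · -- reads some `x₁ ≢ x₀ (mod ℤ^ι)` at `b₁`, hence reads `x₁` nearby, hence not `x₀` nearby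
      obtain ⟨x₁, -, hx₁⟩ := hdiv b₁ hb₁
      have hev := h.eventually_sectionReading_of_reading hVU hpσ hm hdiv hb₁ (hσ b₁ hb₁) hx₁
      refine (continuousWithinAt_const (b := false)).congr_of_eventuallyEq ?_ (by simp [f, hb])
      filter_upwards [hev, self_mem_nhdsWithin] with b hb' hbV
      have hne : ¬ σ b = ex (b, Φ b x₀) := by
        intro hb0
        obtain ⟨n, hn⟩ := h.reading_unique_mod (hVU hbV) (hb'.symm.trans hb0)
        apply hb
        rw [hx₁, ← h.reading_of_add_int (hVU hb₁) x₁ n, ← hn]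
      simp [f, hne]
  intro b hb
  have hfb : f b = f b₀ := hV.constant hf hb hb₀
  have hf₀ : f b₀ = true := by simp [f, hx₀]
  rw [hf₀] at hfb
  simpa [f] using hfb

end Literature.Geometry.ComplexAnalytic.IsRelExpChartOn

end
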